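import Summits.BirchSwinnertonDyer.BirchSwinnertonDyer.Theorems.ResidualThetaTransportAtTwoResidualSignedLambdaLowerCMAtTwoLocalBlockCountRamified
import Summits.BirchSwinnertonDyer.BirchSwinnertonDyer.Theorems.ResidualThetaTransportAtTwoResidualSignedLambdaLowerCMAtTwoLocalBlockCountSum
import Summits.BirchSwinnertonDyer.BirchSwinnertonDyer.Theorems.ResidualThetaTransportAtTwoAwayDefs
import HarnessLib

/-!
# RSL_g's one-pair count, split stub S1⊕ (`stub_localDualAwayTwo`) — the BODY, assembled in the vocabulary of the S₀-side frame
# (`OnePair.Dloc`, `OnePair.Cosets`, `OnePair.nfl`, `OnePair.PAway`, `OnePair.lamTwo`): FIN of `ℚ₂ ⊗ P_{S₀}` over ALL of `S₀` and the COUNT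
# `f · Σ_{v ∈ S₀} 2^{n_v} · (0 at level v | 2 at even trace | 0 at odd trace) ≤ λ_{ℤ₂}(P_{S₀})`

Route `ResidualThetaTransportAtTwo` (RTT), crux RSL_g `ResidualSignedLambdaLowerCMAtTwo` (stmt-BirchSwinnertonDyer-22608); width seat
`prover-bsd-wall-tp2-p2x-w3` g16 (`--supports 22608 --as helper`, closes nothing). THEOREMS ONLY (no definition, no named fact, no instance, no notation,
no `sorry`). Eighth file of the local-block chain; consumes p698653 (per-block FIN / `lamTwo` value at good places), p701074-lineage
`…LocalBlockCountRamified` (per-block FIN at EVERY `w ∤ 2`, ramified or not), p699058 (`Π/Σ` bookkeeping, `#(Γ_ℚ ⧸ Γ_n) = 2^n`) and the LEAD's frame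
`Theorems/ResidualThetaTransportAtTwoAwayDefs.lean` (p697975). The S1⊕ split text (LEAD rtt-p2 g18, bus 2026-08-29T05:23:34Z) reads, after its habitat binders,
`Module.Finite ℚ_[2] (ℚ_[2] ⊗[ℤ_[2]] PAway (Set.range ι) κ ρ S₀) ∧ π.f * (∑ v ∈ S₀, 2 ^ nfl v * (if natGenerator v ∣ M then 0 else if ‖embCoeff g ι (natGenerator v)‖ < 1
then 2 else 0)) ≤ lamTwo 2 (PAway (Set.range ι) κ ρ S₀)`; this file proves exactly that body from the habitat data it depends on:

* §1 (one block, frame vocabulary, ANY binder instance `[Module ℤ_[2] (Dloc S κ ρ w)]`, `κ` cyclotomic, `w ∤ 2`): `module_finite_characterModule_dloc`,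
  `module_finite_baseChange_characterModule_dloc` (FIN, no ramification hypothesis), `lamTwo_characterModule_dloc_eq` (`= f·(if ‖a‖ < 1 then 2 else 0)` at a good
  place: `ρ` unramified with Frobenius polynomial `X² − a X + ℓ_w`), `odd_natGenerator`, `natCard_cosets_eq` (`#C_w = 2^{n_w}`), `finite_cosets`.
* §2 **`finite_and_sum_le_lamTwo_PAway`** — THE S1⊕ BODY: for `κ` cyclotomic, `S₀` a finite set of odd places, `M`, a coefficient sequence `a : ℕ → PadicAlgCl 2`
  (`:= embCoeff g ι`), the habitat clause `hρ` VERBATIM (`∀ v, ¬ ℓ_v ∣ 2M → ρ.IsUnramifiedAt v ∧ ∃ P, P.map _ = X² − C (a ℓ_v) X + C ℓ_v ∧ ρ.HasFrobCharpolyAt v P`),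
  `ϖ` irreducible, `B : ℤ₂^f ≃+ 𝒪` (`:= π.B`), and binder instances `[∀ w : ↥S₀, Module ℤ_[2] (Dloc S κ ρ ↑w)]`:
  `Module.Finite ℚ_[2] (ℚ_[2] ⊗[ℤ_[2]] PAway S κ ρ S₀) ∧ f * (∑ v ∈ S₀, 2 ^ nfl v * (if ℓ_v ∣ M then 0 else if ‖a ℓ_v‖ < 1 then 2 else 0)) ≤ lamTwo 2 (PAway S κ ρ S₀)`
  (FIN: every block is finitely generated, `S₀` and each `C_w` are finite; COUNT: p699058's `sum_mul_le_finrank_baseChange_pi_fun` with the per-block value at the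
  good places and `0 ≤ ·` at the level places). With `S := Set.range ι`, `a := embCoeff g ι`, `f, B := π.f, π.B` this is the registered text after its binders.

BSD is not proved by any of this; RSL_g (22608) is not proved here.
References: [GreenbergVatsal2000] §1 p. 7, §2 Prop. (2.4) and proof (arXiv p. 22); [Kato2004Asterisque] §13.8 (p. 228); [Washington1997] §13.1;
[Greenberg2006] §3 A (proof of Prop. 3.2); [MilneADT2006] Ch. I, Thm. 4.10.
-/

set_option autoImplicit false
-- the Theorems namespace of this sub repeats the summit name by design (D-0017 nested layout)
set_option linter.dupNamespace false

noncomputable section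

open scoped Classical TensorProduct

namespace Summit.BirchSwinnertonDyer.BirchSwinnertonDyer.Theorems.ThetaTransport.LocalBlockCount

open NumberField IsDedekindDomain Field Rat.HeightOneSpectrum
open Literature.NumberTheory.EllipticCurves Literature.NumberTheory.GaloisRepresentations
  Literature.NumberTheory.EllipticCurves.GreenbergSelmer IsDedekindDomain.HeightOneSpectrum
  Summit.BirchSwinnertonDyer.BirchSwinnertonDyer.Theorems.OnePair

/-! ## §1 One block in the frame's vocabulary -/

section Block

variable (S : Set (PadicAlgCl 2)) [FiniteDimensional ℚ_[2] (padicCoeffField S)] (κ : ZpExtension ℚ 2)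
  (ρ : FramedGaloisRep ℚ (padicCoeffIntegers S) 2) (w : HeightOneSpectrum (𝓞 ℚ))

omit [FiniteDimensional ℚ_[2] (padicCoeffField S)] in
/-- `ℓ_w = natGenerator w` is ODD at a place `w ∌ 2`. [folklore] -/
theorem odd_natGenerator (h2w : ((2 : ℕ) : 𝓞 ℚ) ∉ w.asIdeal) : Odd (natGenerator w) := by
  refine (prime_natGenerator w).odd_of_ne_two fun h ↦ h2w ?_
  have hmem := natCast_natGenerator_mem w
  rwa [h] at hmem

omit [FiniteDimensional ℚ_[2] (padicCoeffField S)] in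
/-- A place `w ∌ 2` with `ℓ_w ∤ M` has `ℓ_w ∤ 2M` (the habitat clause's guard). [folklore] -/
theorem not_natGenerator_dvd_two_mul (h2w : ((2 : ℕ) : 𝓞 ℚ) ∉ w.asIdeal) {M : ℕ} (hM : ¬ natGenerator w ∣ M) : ¬ natGenerator w ∣ 2 * M := by
  intro h
  rcases (Nat.Prime.dvd_mul (prime_natGenerator w)).mp h with h2 | h1
  · have h22 := (Nat.prime_dvd_prime_iff_eq (prime_natGenerator w) Nat.prime_two).mp h2
    exact (Nat.not_even_iff_odd.mpr (odd_natGenerator w h2w)) (h22 ▸ even_two)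
  · exact hM h1

/-- **`#C_w = 2^{n_w}`**: the coset space `Cosets κ w = Γ_ℚ ⧸ Γ_{n_w}` has `2 ^ nfl w` elements. [cite: Washington1997, §13.1] -/
theorem natCard_cosets_eq : Nat.card (Cosets κ w) = 2 ^ nfl w :=
  natCard_quotient_layerSubgroup κ (nfl w)

/-- `Cosets κ w` is finite. [cite: Washington1997, §13.1] -/
theorem finite_cosets : Finite (Cosets κ w) :=
  Nat.finite_of_card_ne_zero (by rw [natCard_cosets_eq]; exact pow_ne_zero _ two_ne_zero)

variable [Module ℤ_[2] (Dloc S κ ρ w)]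

/-- **FIN per block, frame vocabulary: `CharacterModule (Dloc S κ ρ w)` is a finitely generated `ℤ₂`-module** at every `w ∤ 2` (`κ` cyclotomic, so `w` is not
split completely; ANY binder `ℤ₂`-structure; `ρ` ramified at `w` allowed) — `module_finite_characterModule_subgroupH1_cofree'` read through `Dloc = subgroupH1 … (rfl)`.
[cite: GreenbergVatsal2000, §2 Prop. (2.4)] [cite: Greenberg2006, §3 A (proof of Prop. 3.2)] -/
theorem module_finite_characterModule_dloc (hκ : κ.IsCyclotomic) (h2w : ((2 : ℕ) : 𝓞 ℚ) ∉ w.asIdeal) :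
    Module.Finite ℤ_[2] (CharacterModule (Dloc S κ ρ w)) := by
  letI : Module ℤ_[2] (subgroupH1 (localSubgroup κ.kerSubgroup (w.adicCompletion ℚ)) (Cofree (ρ.toLocal w) (padicCoeffField S))) :=
    ‹Module ℤ_[2] (Dloc S κ ρ w)›
  exact module_finite_characterModule_subgroupH1_cofree' S ρ κ h2w (exists_not_mem_localSubgroup_of_isCyclotomic κ hκ w)

/-- **FIN per block in PUSH's binder form: `Module.Finite ℚ₂ (ℚ₂ ⊗_{ℤ₂} CharacterModule (Dloc S κ ρ w))`** at every `w ∤ 2`. [cite: GreenbergVatsal2000, §2 Prop. (2.4)] -/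
theorem module_finite_baseChange_characterModule_dloc (hκ : κ.IsCyclotomic) (h2w : ((2 : ℕ) : 𝓞 ℚ) ∉ w.asIdeal) :
    Module.Finite ℚ_[2] (ℚ_[2] ⊗[ℤ_[2]] CharacterModule (Dloc S κ ρ w)) := by
  haveI := module_finite_characterModule_dloc S κ ρ w hκ h2w
  infer_instance

/-- **COUNT per GOOD block, frame vocabulary: `lamTwo 2 (CharacterModule (Dloc S κ ρ w)) = f · (if ‖a‖ < 1 then 2 else 0)`** for `ρ` unramified at `w ∤ 2` with
Frobenius polynomial `X² − a X + ℓ_w` (`ℓ_w` odd), `ϖ` irreducible, `B : ℤ₂^f ≃+ 𝒪`; ANY binder `ℤ₂`-structure (p698653's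
`finrank_baseChange_characterModule_subgroupH1_cofree_eq`). [cite: GreenbergVatsal2000, §2 Prop. (2.4)] [cite: Kato2004Asterisque, §13.8 (p. 228)] -/
theorem lamTwo_characterModule_dloc_eq (hκ : κ.IsCyclotomic) (h2w : ((2 : ℕ) : 𝓞 ℚ) ∉ w.asIdeal) (hur : FramedGaloisRep.IsUnramifiedAt w ρ)
    {P : Polynomial (padicCoeffIntegers S)} (hP : FramedGaloisRep.HasFrobCharpolyAt w P ρ) {a : PadicAlgCl 2}
    (hPmap : P.map (padicCoeffIntegers S).subtype = Polynomial.X ^ 2 - Polynomial.C a * Polynomial.X + Polynomial.C ((natGenerator w : ℕ) : PadicAlgCl 2))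
    {ϖ : padicCoeffIntegers S} (hϖ : Irreducible ϖ) {f : ℕ} (B : (Fin f → ℤ_[2]) ≃+ padicCoeffIntegers S) :
    lamTwo 2 (CharacterModule (Dloc S κ ρ w)) = f * (if ‖a‖ < 1 then 2 else 0) := by
  letI : Module ℤ_[2] (subgroupH1 (localSubgroup κ.kerSubgroup (w.adicCompletion ℚ)) (Cofree (ρ.toLocal w) (padicCoeffField S))) :=
    ‹Module ℤ_[2] (Dloc S κ ρ w)›
  rw [lamTwo_eq]
  exact finrank_baseChange_characterModule_subgroupH1_cofree_eq S ρ κ h2w (exists_not_mem_localSubgroup_of_isCyclotomic κ hκ w) hur hP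
    (odd_natGenerator w h2w) hPmap hϖ B

end Block

/-! ## §2 The S1⊕ body -/

section Body

variable (S : Set (PadicAlgCl 2)) [FiniteDimensional ℚ_[2] (padicCoeffField S)] (κ : ZpExtension ℚ 2)
  (ρ : FramedGaloisRep ℚ (padicCoeffIntegers S) 2) (S₀ : Finset (HeightOneSpectrum (𝓞 ℚ)))

/-- **S1⊕ (`stub_localDualAwayTwo`) — THE BODY: `ℚ₂ ⊗ P_{S₀}` is finite-dimensional and
`f · Σ_{v ∈ S₀} 2^{n_v} · (if ℓ_v ∣ M then 0 else if ‖a ℓ_v‖ < 1 then 2 else 0) ≤ λ_{ℤ₂}(P_{S₀})`**, for `κ` cyclotomic, `S₀` a finite set of places `∌ 2`, the habitat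
clause `hρ` (at `ℓ_v ∤ 2M`: `ρ` unramified with Frobenius polynomial `X² − a ℓ_v · X + ℓ_v`), `ϖ` irreducible, `B : ℤ₂^f ≃+ 𝒪`, and ANY binder `ℤ₂`-structures on
the `Dloc S κ ρ w`. FIN holds at every block (`module_finite_characterModule_dloc`, ramified level places included); the COUNT is the sum of the per-block
values `lamTwo (CharacterModule D_w) = f·(if ‖a‖ < 1 then 2 else 0)` over the `#C_w = 2^{n_w}` copies at the good places and `0 ≤ ·` at the level places
(`sum_mul_le_finrank_baseChange_pi_fun`). With `S := Set.range ι`, `a := embCoeff g ι`, `f, B := π.f, π.B` this is the S1⊕ split text after its binders.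
[cite: GreenbergVatsal2000, §1 p. 7, §2 Prop. (2.4)] [cite: Kato2004Asterisque, §13.8 (p. 228)] [cite: Washington1997, §13.1] -/
theorem finite_and_sum_le_lamTwo_PAway (hκ : κ.IsCyclotomic) (h2 : ∀ v ∈ S₀, ((2 : ℕ) : 𝓞 ℚ) ∉ v.asIdeal) (M : ℕ) (a : ℕ → PadicAlgCl 2)
    (hρ : ∀ v : HeightOneSpectrum (𝓞 ℚ), ¬ natGenerator v ∣ 2 * M → FramedGaloisRep.IsUnramifiedAt v ρ ∧
      ∃ P : Polynomial (padicCoeffIntegers S), P.map (padicCoeffIntegers S).subtype =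
        Polynomial.X ^ 2 - Polynomial.C (a (natGenerator v)) * Polynomial.X + Polynomial.C ((natGenerator v : ℕ) : PadicAlgCl 2) ∧
        FramedGaloisRep.HasFrobCharpolyAt v P ρ)
    {ϖ : padicCoeffIntegers S} (hϖ : Irreducible ϖ) {f : ℕ} (B : (Fin f → ℤ_[2]) ≃+ padicCoeffIntegers S)
    [∀ w : ↥S₀, Module ℤ_[2] (Dloc S κ ρ (w : HeightOneSpectrum (𝓞 ℚ)))] :
    Module.Finite ℚ_[2] (ℚ_[2] ⊗[ℤ_[2]] PAway S κ ρ S₀) ∧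
      f * (∑ v ∈ S₀, 2 ^ nfl v * (if natGenerator v ∣ M then 0 else (if ‖a (natGenerator v)‖ < 1 then 2 else 0))) ≤ lamTwo 2 (PAway S κ ρ S₀) := by
  haveI hfinw : ∀ w : ↥S₀, Module.Finite ℤ_[2] (CharacterModule (Dloc S κ ρ (w : HeightOneSpectrum (𝓞 ℚ)))) :=
    fun w ↦ module_finite_characterModule_dloc S κ ρ w hκ (h2 w w.2)
  haveI : ∀ w : ↥S₀, Fintype (Cosets κ (w : HeightOneSpectrum (𝓞 ℚ))) := fun w ↦ @Fintype.ofFinite _ (finite_cosets κ w)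
  refine ⟨module_finite_baseChange_pi 2 (fun w : ↥S₀ ↦ Cosets κ (w : HeightOneSpectrum (𝓞 ℚ)) → CharacterModule (Dloc S κ ρ (w : HeightOneSpectrum (𝓞 ℚ)))), ?_⟩
  -- the count
  have hsum : ∑ v ∈ S₀, 2 ^ nfl v * (if natGenerator v ∣ M then 0 else (if ‖a (natGenerator v)‖ < 1 then 2 else 0)) =
      ∑ w : ↥S₀, Fintype.card (Cosets κ (w : HeightOneSpectrum (𝓞 ℚ))) *
        (if natGenerator (w : HeightOneSpectrum (𝓞 ℚ)) ∣ M then 0 else (if ‖a (natGenerator (w : HeightOneSpectrum (𝓞 ℚ)))‖ < 1 then 2 else 0)) := by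
    rw [← Finset.sum_coe_sort S₀]
    refine Finset.sum_congr rfl fun w _ ↦ ?_
    rw [Fintype.card_eq_nat_card, natCard_cosets_eq]
  rw [lamTwo_eq, hsum]
  refine sum_mul_le_finrank_baseChange_pi_fun 2 (fun w : ↥S₀ ↦ Cosets κ (w : HeightOneSpectrum (𝓞 ℚ)))
    (fun w : ↥S₀ ↦ CharacterModule (Dloc S κ ρ (w : HeightOneSpectrum (𝓞 ℚ)))) f _ fun w ↦ ?_
  by_cases hM : natGenerator (w : HeightOneSpectrum (𝓞 ℚ)) ∣ M
  · simp only [hM, if_true, mul_zero]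
    exact Nat.zero_le _
  · simp only [hM, if_false]
    obtain ⟨hur, P, hPmap, hP⟩ := hρ w (not_natGenerator_dvd_two_mul (w : HeightOneSpectrum (𝓞 ℚ)) (h2 w w.2) hM)
    rw [← lamTwo_eq, lamTwo_characterModule_dloc_eq S κ ρ w hκ (h2 w w.2) hur hP hPmap hϖ B]

end Body

end Summit.BirchSwinnertonDyer.BirchSwinnertonDyer.Theorems.ThetaTransport.LocalBlockCount

end
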